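import Mathlib
import Literature.Analysis.Matrix.DetAddDiagonalMinors

/-!
# `MatrixDescartes` census — FLAG ASYMPTOTICS: the sign of `det (M + diagonal (σ_a r_a^D))` for `D → ∞`

HONEST FRAMING.  Object-search cell `pub-symmetroid`, crux `Theses.LacunarySymmetroid.MatrixDescartes`
(stmt-ValiantsHypothesis-18050); seat val-sym-mdr-p1 (g2).  A pure lemma file (no definitions, no claims about the crux or about
`VP ≠ VNP`): the kernel form of the cell's REGIME / FLAG LEMMA mechanism (`HOME/CONJECTURE.md` §2.1c) at ONE test point.  For a real
square matrix `M`, nonzero signs `σ_a` and positive ratios `r_a ≠ 1`, write `ON = {a : 1 < r_a}` and `OFF = {a : r_a < 1}`.  Then, as the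
lacunarity `D → ∞`,

  `det (M + diagonal (a ↦ σ_a · r_a ^ D)) / ∏_{a ∈ ON} (σ_a · r_a ^ D) ⟶ det (M restricted to OFF)`

(`tendsto_det_add_diagonal_div`): in the principal-minor expansion of the diagonal shift (Literature
`det_add_diagonal_eq_sum_minors`) the subset `OFF` carries the uniquely largest geometric rate.  Consequently, if the `OFF`-minor is
nonzero, the sign of `det (M + diagonal (σ_a r_a^D))` is eventually `sign (∏_{ON} σ_a) · sign det(M|OFF)` (`eventually_det_mul_pos`).  In the
companion files the test point `t` of a lacunary pencil `A + t·B + t^D·diagonal(σ_a τ_a^{-D})` has `r_a = t/τ_a`, `ON` = the flag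
coordinates already switched on at `t`, and `det(M|OFF)` = a leading principal minor of the Lagrange tower. [folklore]
-/

-- `Summit.ValiantsHypothesis.ValiantsHypothesis.…` repeats a component by the D-0017 layout
-- (single-conjunct summit), which the `dupNamespace` linter flags; the name is mandated.
set_option linter.dupNamespace false

namespace Summit.ValiantsHypothesis.ValiantsHypothesis.Theorems.LacunarySymmetroidMatrixDescartes.Census.Flag

open Matrix Finset Filter Topology
open scoped BigOperators

section Helpers

variable {ι : Type*} [DecidableEq ι]

/-- A product of reals in `[0,1]` is `≤ 1`, and `< 1` as soon as one factor is `< 1` (all factors nonnegative). [folklore] -/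
theorem prod_lt_one_of_mem {s : Finset ι} {f : ι → ℝ} (h0 : ∀ i ∈ s, 0 ≤ f i) (h1 : ∀ i ∈ s, f i ≤ 1)
    {a : ι} (ha : a ∈ s) (hfa : f a < 1) : ∏ i ∈ s, f i < 1 := by
  rw [← Finset.mul_prod_erase s f ha]
  have h2 : ∏ i ∈ s.erase a, f i ≤ 1 :=
    Finset.prod_le_one (fun i hi => h0 i (Finset.mem_of_mem_erase hi)) fun i hi => h1 i (Finset.mem_of_mem_erase hi)
  have h3 : 0 ≤ ∏ i ∈ s.erase a, f i := Finset.prod_nonneg fun i hi => h0 i (Finset.mem_of_mem_erase hi)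
  have h4 : 0 ≤ f a := h0 a ha
  nlinarith

/-- A product of reals `≥ 1` is `≥ 1`, and `> 1` as soon as one factor is `> 1`. [folklore] -/
theorem one_lt_prod_of_mem {s : Finset ι} {f : ι → ℝ} (h1 : ∀ i ∈ s, 1 ≤ f i)
    {a : ι} (ha : a ∈ s) (hfa : 1 < f a) : 1 < ∏ i ∈ s, f i := by
  rw [← Finset.mul_prod_erase s f ha]
  have h2 : 1 ≤ ∏ i ∈ s.erase a, f i := by
    have := Finset.prod_le_prod (s := s.erase a) (f := fun _ => (1 : ℝ)) (g := f) (fun _ _ => zero_le_one)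
      fun i hi => h1 i (Finset.mem_of_mem_erase hi)
    simpa using this
  nlinarith

end Helpers

variable {ι : Type*} [Fintype ι] [DecidableEq ι]

/-- **Unique maximal subset product.**  For positive `r_a ≠ 1`, the product `∏_{a ∈ T} r_a` over a subset `T` is strictly
smaller than over `ON = {a : 1 < r_a}` unless `T = ON`. [folklore] -/
theorem prod_lt_prod_on {r : ι → ℝ} (hr : ∀ a, 0 < r a) (hr1 : ∀ a, r a ≠ 1) {T : Finset ι}
    (hT : T ≠ univ.filter (fun a => 1 < r a)) :
    ∏ a ∈ T, r a < ∏ a ∈ univ.filter (fun a => 1 < r a), r a := by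
  set ON := univ.filter (fun a => 1 < r a) with hON
  have hmemON : ∀ a, a ∈ ON ↔ 1 < r a := fun a => by simp [hON]
  rw [← Finset.prod_inter_mul_prod_sdiff T ON r, ← Finset.prod_inter_mul_prod_sdiff ON T r, Finset.inter_comm ON T]
  have hpos : 0 < ∏ a ∈ T ∩ ON, r a := Finset.prod_pos fun a _ => hr a
  -- factors outside `ON` are `< 1`, factors in `ON` are `> 1`
  have hle1 : ∀ a ∈ T \ ON, r a ≤ 1 := fun a ha => by
    have : a ∉ ON := (Finset.mem_sdiff.mp ha).2
    rw [hmemON] at this; exact not_lt.mp this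
  have hge1 : ∀ a ∈ ON \ T, 1 ≤ r a := fun a ha => by
    have : a ∈ ON := (Finset.mem_sdiff.mp ha).1
    rw [hmemON] at this; exact this.le
  have hA : ∏ a ∈ T \ ON, r a ≤ 1 := Finset.prod_le_one (fun a _ => (hr a).le) hle1
  have hB : 1 ≤ ∏ a ∈ ON \ T, r a := by
    have := Finset.prod_le_prod (s := ON \ T) (f := fun _ => (1 : ℝ)) (g := r) (fun _ _ => zero_le_one) hge1
    simpa using this
  -- one of the two differences is nonempty
  by_cases h1 : (T \ ON).Nonempty
  · obtain ⟨a, ha⟩ := h1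
    have hlt : ∏ a ∈ T \ ON, r a < 1 := by
      refine prod_lt_one_of_mem (fun a _ => (hr a).le) hle1 ha ?_
      have : a ∉ ON := (Finset.mem_sdiff.mp ha).2
      rw [hmemON] at this
      exact lt_of_le_of_ne (not_lt.mp this) (hr1 a)
    calc (∏ a ∈ T ∩ ON, r a) * ∏ a ∈ T \ ON, r a < (∏ a ∈ T ∩ ON, r a) * 1 := by
          exact mul_lt_mul_of_pos_left hlt hpos
      _ ≤ (∏ a ∈ T ∩ ON, r a) * ∏ a ∈ ON \ T, r a := by
          rw [mul_one]; exact le_mul_of_one_le_right hpos.le hB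
  · have h2 : (ON \ T).Nonempty := by
      rw [Finset.not_nonempty_iff_eq_empty, Finset.sdiff_eq_empty_iff_subset] at h1
      by_contra h3
      rw [Finset.not_nonempty_iff_eq_empty, Finset.sdiff_eq_empty_iff_subset] at h3
      exact hT (Finset.Subset.antisymm h1 h3)
    obtain ⟨a, ha⟩ := h2
    have hgt : 1 < ∏ a ∈ ON \ T, r a := by
      refine one_lt_prod_of_mem hge1 ha ?_
      have : a ∈ ON := (Finset.mem_sdiff.mp ha).1
      rwa [hmemON] at this
    calc (∏ a ∈ T ∩ ON, r a) * ∏ a ∈ T \ ON, r a ≤ (∏ a ∈ T ∩ ON, r a) * 1 :=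
          mul_le_mul_of_nonneg_left hA hpos.le
      _ < (∏ a ∈ T ∩ ON, r a) * ∏ a ∈ ON \ T, r a := by
          rw [mul_one]; exact lt_mul_of_one_lt_right hpos hgt

/-- **FLAG ASYMPTOTICS (limit form).**  For nonzero signs `σ_a` and positive ratios `r_a ≠ 1`, with `ON = {a : 1 < r_a}`,
`det (M + diagonal (σ_a r_a^D)) / ∏_{ON} (σ_a r_a^D) → det (M | ONᶜ)` as `D → ∞`. [folklore] -/
theorem tendsto_det_add_diagonal_div (M : Matrix ι ι ℝ) (σ r : ι → ℝ) (hσ : ∀ a, σ a ≠ 0)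
    (hr : ∀ a, 0 < r a) (hr1 : ∀ a, r a ≠ 1) :
    Tendsto (fun D : ℕ => (M + diagonal (fun a => σ a * r a ^ D)).det /
        ∏ a ∈ univ.filter (fun a => 1 < r a), (σ a * r a ^ D)) atTop
      (𝓝 ((M.submatrix ((↑) : ↥(univ.filter (fun a => 1 < r a))ᶜ → ι)
        ((↑) : ↥(univ.filter (fun a => 1 < r a))ᶜ → ι)).det)) := by
  classical
  set ON := univ.filter (fun a => 1 < r a) with hON
  set OFF := ONᶜ with hOFF
  -- constants of the expansion
  let c : Finset ι → ℝ := fun S =>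
    (∏ a ∈ Sᶜ, σ a) / (∏ a ∈ ON, σ a) * (M.submatrix ((↑) : S → ι) ((↑) : S → ι)).det
  let ρ : Finset ι → ℝ := fun S => (∏ a ∈ Sᶜ, r a) / ∏ a ∈ ON, r a
  have hσON : ∏ a ∈ ON, σ a ≠ 0 := Finset.prod_ne_zero_iff.mpr fun a _ => hσ a
  have hrON : 0 < ∏ a ∈ ON, r a := Finset.prod_pos fun a _ => hr a
  have key : ∀ D : ℕ, (M + diagonal (fun a => σ a * r a ^ D)).det / ∏ a ∈ ON, (σ a * r a ^ D)
      = ∑ S : Finset ι, c S * ρ S ^ D := by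
    intro D
    rw [Literature.Analysis.Matrix.det_add_diagonal_eq_sum_minors, Finset.sum_div]
    refine Finset.sum_congr rfl fun S _ => ?_
    simp only [c, ρ, Finset.prod_mul_distrib, Finset.prod_pow, div_pow]
    have h1 : (∏ a ∈ ON, r a) ^ D ≠ 0 := pow_ne_zero _ hrON.ne'
    field_simp
  simp_rw [key]
  -- the limit, written as a sum of the termwise limits
  have hlim : (M.submatrix ((↑) : OFF → ι) ((↑) : OFF → ι)).det
      = ∑ S : Finset ι, (if S = OFF then (M.submatrix ((↑) : OFF → ι) ((↑) : OFF → ι)).det else 0) := by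
    simp only [Finset.sum_ite_eq', Finset.mem_univ, if_true]
  rw [hlim]
  refine tendsto_finsetSum _ fun S _ => ?_
  by_cases hS : S = OFF
  · subst hS
    have hc0 : OFFᶜ = ON := by rw [hOFF, compl_compl]
    have hc : c OFF = (M.submatrix ((↑) : OFF → ι) ((↑) : OFF → ι)).det := by
      simp only [c, hc0, div_self hσON, one_mul]
    have hρ : ρ OFF = 1 := by simp only [ρ, hc0, div_self hrON.ne']
    have hif : (if OFF = OFF then (M.submatrix ((↑) : OFF → ι) ((↑) : OFF → ι)).det else 0)
        = (M.submatrix ((↑) : OFF → ι) ((↑) : OFF → ι)).det := if_pos rfl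
    rw [hif]
    simp_rw [hc, hρ, one_pow, mul_one]
    exact tendsto_const_nhds
  · simp only [hS, if_false]
    have hρ0 : 0 ≤ ρ S := div_nonneg (Finset.prod_nonneg fun a _ => (hr a).le) hrON.le
    have hρ1 : ρ S < 1 := by
      rw [div_lt_one hrON]
      refine prod_lt_prod_on hr hr1 ?_
      intro h
      change Sᶜ = ON at h
      exact hS (by rw [hOFF, ← h, compl_compl])
    have := (tendsto_pow_atTop_nhds_zero_of_lt_one hρ0 hρ1).const_mul (c S)
    simpa using this

/-- **FLAG ASYMPTOTICS (sign form).**  If the `OFF`-minor `L` is nonzero, then for all large `D` the determinant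
`det (M + diagonal (σ_a r_a^D))` has the sign of `(∏_{ON} σ_a) · L`. [folklore] -/
theorem eventually_det_mul_pos (M : Matrix ι ι ℝ) (σ r : ι → ℝ) (hσ : ∀ a, σ a ≠ 0)
    (hr : ∀ a, 0 < r a) (hr1 : ∀ a, r a ≠ 1)
    (hL : (M.submatrix ((↑) : ↥(univ.filter (fun a => 1 < r a))ᶜ → ι)
        ((↑) : ↥(univ.filter (fun a => 1 < r a))ᶜ → ι)).det ≠ 0) :
    ∀ᶠ D : ℕ in atTop, 0 < (M + diagonal (fun a => σ a * r a ^ D)).det *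
        ((∏ a ∈ univ.filter (fun a => 1 < r a), σ a) *
          (M.submatrix ((↑) : ↥(univ.filter (fun a => 1 < r a))ᶜ → ι)
            ((↑) : ↥(univ.filter (fun a => 1 < r a))ᶜ → ι)).det) := by
  set L := (M.submatrix ((↑) : ↥(univ.filter (fun a => 1 < r a))ᶜ → ι)
    ((↑) : ↥(univ.filter (fun a => 1 < r a))ᶜ → ι)).det with hLdef
  have hlim := tendsto_det_add_diagonal_div M σ r hσ hr hr1
  -- eventually the quotient `q_D` satisfies `0 < q_D · L`
  have hopen : IsOpen {y : ℝ | 0 < y * L} := isOpen_lt continuous_const (continuous_id.mul continuous_const)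
  have hmem : L ∈ {y : ℝ | 0 < y * L} := by
    show 0 < L * L; exact mul_self_pos.mpr hL
  have hev := hlim.eventually (hopen.mem_nhds hmem)
  filter_upwards [hev] with D hD
  set P := ∏ a ∈ univ.filter (fun a => 1 < r a), (σ a * r a ^ D) with hPdef
  set q := (M + diagonal (fun a => σ a * r a ^ D)).det / P with hq
  have hD' : 0 < q * L := hD
  have hσON : ∏ a ∈ univ.filter (fun a => 1 < r a), σ a ≠ 0 := Finset.prod_ne_zero_iff.mpr fun a _ => hσ a
  have hrD : 0 < ∏ a ∈ univ.filter (fun a => 1 < r a), r a ^ D := Finset.prod_pos fun a _ => pow_pos (hr a) D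
  have hP : P = (∏ a ∈ univ.filter (fun a => 1 < r a), σ a) * ∏ a ∈ univ.filter (fun a => 1 < r a), r a ^ D :=
    Finset.prod_mul_distrib
  have hPne : P ≠ 0 := by rw [hP]; exact mul_ne_zero hσON hrD.ne'
  have hdet : (M + diagonal (fun a => σ a * r a ^ D)).det = q * P := by rw [hq, div_mul_cancel₀ _ hPne]
  rw [hdet, hP]
  have hsq : 0 < (∏ a ∈ univ.filter (fun a => 1 < r a), σ a) * ∏ a ∈ univ.filter (fun a => 1 < r a), σ a :=
    mul_self_pos.mpr hσON
  have : q * ((∏ a ∈ univ.filter (fun a => 1 < r a), σ a) * ∏ a ∈ univ.filter (fun a => 1 < r a), r a ^ D) *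
        ((∏ a ∈ univ.filter (fun a => 1 < r a), σ a) * L)
      = (q * L) * (((∏ a ∈ univ.filter (fun a => 1 < r a), σ a) *
          ∏ a ∈ univ.filter (fun a => 1 < r a), σ a) * ∏ a ∈ univ.filter (fun a => 1 < r a), r a ^ D) := by
    ring
  rw [this]
  exact mul_pos hD' (mul_pos hsq hrD)

end Summit.ValiantsHypothesis.ValiantsHypothesis.Theorems.LacunarySymmetroidMatrixDescartes.Census.Flag
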